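import Mathlib
import Literature.AlgebraicGeometry.Resolution.HironakaDirectrixSpan
import Literature.AlgebraicGeometry.Resolution.HironakaDirectrixLemmas
import Literature.AlgebraicGeometry.Resolution.PlaneNearForms
import HarnessLib

/-!
# `τ = 1`: all initial forms are multiples of one `μ`-th power of a linear form

Topic: `Literature/AlgebraicGeometry/Resolution`. Cossart–Piltant 2008, §4, p. 11: "For each
point `x(i) ∈ Σ(i)` with `τ(x(i)) = 1` … Let `(y, u₁, u₂)` be a r.s.p. such that `T_x = k(x)·Y`";
Cossart–Jannsen–Saito, LNM 2270, Ch. 12, Case `e_x(X) = 2` with `r = 1`: `in_𝔪(f) = F(Y) = c Y^{n}`.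
With the tree's directrix (`HironakaDirectrix*`: `S ⊆ k[T(S)]`, `τ(S) = dim T(S)`), we PROVE
(no facts):

* `eq_C_mul_pow_of_mem_adjoin_singleton` — a form of degree `μ` lying in `k[ℓ̂]` for a linear
  form `ℓ̂` is `a · ℓ̂^μ`;
* `exists_forall_eq_C_mul_pow_of_hironakaTau_eq_one` — **if `τ(S) = 1` then there is a linear
  functional `ℓ ≠ 0` with `F = a_F · ℓ̂^μ` for every form `F ∈ S` of degree `μ`**;
* `exists_forall_initialForms_eq_of_hironakaTauAt_eq_one` — the same for `cl_μ(J)` at a point.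

## Sources

* V. Cossart, O. Piltant, J. Algebra 320 (2008), §4 p. 11; proof of Prop. 4.2. [CossartPiltant2008]
* V. Cossart, U. Jannsen, S. Saito, LNM 2270 (2020), Ch. 12 (setup), Def. 1.26. [CossartJannsenSaito2020]
-/

noncomputable section

open MvPolynomial

namespace Literature.AlgebraicGeometry.Resolution

universe u

section Field

variable (k : Type u) [Field k] {d : ℕ}

/-- **A form of degree `μ` in `k[ℓ̂]`, `ℓ̂` a linear form, is `a · ℓ̂^μ`.** [folklore] -/
theorem eq_C_mul_pow_of_mem_adjoin_singleton {L F : MvPolynomial (Fin d) k} (hL : L.IsHomogeneous 1)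
    (hF : F ∈ Algebra.adjoin k {L}) {μ : ℕ} (hFμ : F.IsHomogeneous μ) :
    ∃ a : k, F = C a * L ^ μ := by
  rw [Algebra.adjoin_singleton_eq_range_aeval] at hF
  obtain ⟨P, hP⟩ := hF
  change Polynomial.aeval L P = F at hP
  subst hP
  refine ⟨P.coeff μ, ?_⟩
  have hpow : ∀ i, (L ^ i).IsHomogeneous i := fun i => by simpa using hL.pow i
  have h1 : homogeneousComponent μ (Polynomial.aeval L P) = Polynomial.aeval L P := by
    rw [homogeneousComponent_of_mem ((mem_homogeneousSubmodule _ _).mpr hFμ), if_pos rfl]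
  rw [← h1, Polynomial.aeval_eq_sum_range, map_sum, Finset.sum_eq_single μ]
  · rw [map_smul, homogeneousComponent_of_mem ((mem_homogeneousSubmodule _ _).mpr (hpow μ)),
      if_pos rfl, smul_eq_C_mul]
  · intro i _ hne
    rw [map_smul, homogeneousComponent_of_mem ((mem_homogeneousSubmodule _ _).mpr (hpow i)),
      if_neg (Ne.symm hne), smul_zero]
  · intro hμ
    rw [Finset.mem_range, not_lt] at hμ
    rw [map_smul, Polynomial.coeff_eq_zero_of_natDegree_lt (by omega), zero_smul]

/-- `k[T']` for a line `T' = k ℓ` is `k[ℓ̂]`. [folklore] -/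
theorem linearFormsSubalgebra_le_adjoin_of_forall_exists_smul {T' : Submodule k (Module.Dual k (Fin d → k))}
    {ℓ : Module.Dual k (Fin d → k)} (hT' : ∀ m ∈ T', ∃ a : k, a • ℓ = m) :
    linearFormsSubalgebra k T' ≤ Algebra.adjoin k {linearFormPoly k ℓ} := by
  rw [linearFormsSubalgebra]
  refine Algebra.adjoin_le ?_
  rintro _ ⟨m, hm, rfl⟩
  obtain ⟨a, rfl⟩ := hT' m hm
  rw [SetLike.mem_coe, linearFormPoly_smul, ← MvPolynomial.algebraMap_eq]
  exact Subalgebra.mul_mem _ (Subalgebra.algebraMap_mem _ a) (Algebra.subset_adjoin rfl)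

/-- **`τ(S) = 1` ⇒ every form in `S` is a multiple of a power of one linear form**: there is a
linear functional `ℓ ≠ 0` (spanning the directrix) with `F = a_F · ℓ̂^μ` for every `F ∈ S`
homogeneous of degree `μ`. [cite: CossartPiltant2008, §4 p. 11] -/
theorem exists_forall_eq_C_mul_pow_of_hironakaTau_eq_one {S : Set (MvPolynomial (Fin d) k)}
    (hτ : hironakaTau k S = 1) :
    ∃ ℓ : Module.Dual k (Fin d → k), ℓ ≠ 0 ∧ ℓ ∈ directrix k S ∧
      ∀ F ∈ S, ∀ μ : ℕ, F.IsHomogeneous μ → ∃ a : k, F = C a * linearFormPoly k ℓ ^ μ := by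
  rw [hironakaTau] at hτ
  have hne : directrix k S ≠ ⊥ := by
    intro h; rw [h, finrank_bot] at hτ; exact zero_ne_one hτ
  obtain ⟨v, hvmem, hv0⟩ := Submodule.exists_mem_ne_zero_of_ne_bot hne
  have hspan : (k ∙ v) = directrix k S := by
    refine Submodule.eq_of_le_of_finrank_eq ((Submodule.span_singleton_le_iff_mem _ _).mpr hvmem) ?_
    rw [finrank_span_singleton hv0, hτ]
  have hv : ∀ w ∈ directrix k S, ∃ c : k, c • v = w := fun w hw => by
    rw [← hspan, Submodule.mem_span_singleton] at hw
    exact hw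
  refine ⟨v, hv0, hvmem, ?_⟩
  intro F hF μ hFμ
  have hmem : F ∈ linearFormsSubalgebra k (directrix k S) := subset_linearFormsSubalgebra_directrix k S hF
  have hle := linearFormsSubalgebra_le_adjoin_of_forall_exists_smul k (T' := directrix k S) (ℓ := v) hv
  exact eq_C_mul_pow_of_mem_adjoin_singleton k (isHomogeneous_linearFormPoly v) (hle hmem) hFμ

end Field

/-! ## At a point -/

section Local

open IsLocalRing

variable {R : Type u} [CommRing R] [IsLocalRing R] {d : ℕ} (c : Fin d → R)

/-- **`τ = 1` at a point**: if `τ(cl_μ(J)) = 1` then all degree-`μ` initial forms of `J` are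
scalar multiples of `ℓ̂^μ` for one linear functional `ℓ ≠ 0` spanning the directrix.
[cite: CossartPiltant2008, §4 p. 11] [cite: CossartJannsenSaito2020, Ch. 12 (setup)] -/
theorem exists_forall_initialForms_eq_of_hironakaTauAt_eq_one {J : Ideal R} {μ : ℕ}
    (hτ : hironakaTauAt c J μ = 1) :
    ∃ ℓ : Module.Dual (ResidueField R) (Fin d → ResidueField R), ℓ ≠ 0 ∧
      ℓ ∈ directrix (ResidueField R) (initialForms c J μ : Set (MvPolynomial (Fin d) (ResidueField R))) ∧
      ∀ G ∈ initialForms c J μ, ∃ a : ResidueField R,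
        G = C a * linearFormPoly (ResidueField R) ℓ ^ μ := by
  obtain ⟨ℓ, hℓ0, hℓd, hℓ⟩ := exists_forall_eq_C_mul_pow_of_hironakaTau_eq_one (ResidueField R) hτ
  exact ⟨ℓ, hℓ0, hℓd, fun G hG => hℓ G hG μ (isHomogeneous_of_mem_initialForms c hG)⟩

end Local

end Literature.AlgebraicGeometry.Resolution
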